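import Summits.QuantumFields.YangMills.Theorems.BalabanUVNodesN21MinimiserResponseRegime

/-!
# N21 (NE7c) · THE MINIMISER'S RESPONSE IN [14] PROP. 6's PRINTED HYPOTHESES: the response road's NODE-O clause and
# its (M1) junction with the contraction REGIME discharged from «ε₄ ≤ a₄, 2B₀C₁B₃ε₁ ≤ ε₄» — BY NAME

Width seat `pub-ymgap-dag-n21-w7` (g0′, harness re-seat; dag-lead WIDTH-209 N21 piece 1 «RADIAL TRANSVERSALITY (α)»,
its [14]-regularity rung), node N21 = NE7c (NOT PRINTED in [Bałaban 1983–89], NOT proved), lane K3⁷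
`SpineGivenEndpointR13SepCoPH` (stmt-QuantumFields-20544, `--kind proof --supports … --as helper`).  File 5 of this seat;
consumes BY NAME file 3 `…N21MinimiserResponseRegime` (★★′-R `psiClause_plaqReading_of_regime`), lit-balaban
`B11Eq174Chart.Regime.ofProp6` (Prop. 6's printed hypotheses give a regime) and n21-w3 f8
`…N21ResponseRoadAtRegularSet` (p598568 ✓: ★★★★ `slotAntiConcentration_restrict_of_projectedCentre_blockExpChart_regular`).

PRINT.  [14] = T. Bałaban, CMP **102** (1985) 277–309, Prop. 6 p. 295: «Let us assume ε₄ ≤ a₄ and ε₁ satisfying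
2B₀C₁B₃ε₁ ≤ ε₄ …» with (117) «< B₀C₁B₃ε₁ + B₀C₄(ε₄ + B₀|B|)²», «|B| < 2dLC₁ε₁», (118), (121); lit-balaban reads `a₄`
as `4ε₄ ≤ a₃ ∧ 16B₀C₄ε₄ ≤ 1` (`B11.ineq118_121`) and packages the conclusion as
`Regime 𝒢 0 W B₀ 0 C₄ a₃ (C₁B₃ε₁) (2dL·B₀C₁ε₁) ε₄` (`Regime.ofProp6`: no linear term, `θ = 0`, as in (116)).

WHAT IS PROVED ([bookkeeping] BY NAME; 0 def, 0 sorry).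
* §1 ★★′-P `psiClause_plaqReading_of_prop6Letters` — f8's `hΨd` VERBATIM on `Reg` with file 3's `Regime` binder
  DISCHARGED into Prop. 6's PRINTED letters: `‖𝔊 f‖ ≤ B₀‖f‖` (Thm 3.13 of [5]), `(δ∕δA′)V` quadratic-analytic with
  `(C₄, a₃)` (Prop. 4), `|J| ≤ C₁B₃ε₁`, `|H₁B| < 2dLB₀C₁ε₁`, numerals `0 ≤ dL ≤ B₃`, `2B₀C₁B₃ε₁ ≤ ε₄`, `4ε₄ ≤ a₃`,
  `16B₀C₄ε₄ ≤ 1`; the analyticity letters, the fine chart `Φ`, the reading identity and unit values as in file 3.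
* §2 ★★★★-R `slotAC_of_blockExpChart_regular_of_regime` — f8 ★★★★ ((M1) on the cut law about the A-projected centre)
  BY NAME with `hΨd := file 3 ★★′-R`; part 34's remaining binders displayed unchanged (the consumer's currency).
* §3 A2∕A6 `prop6Letters_levelZero_witness` — the binder system KEPT by ★★′-P is jointly inhabited in every `𝔄`
  (zero data, `B₀ = C₄ = C₁ = dL = B₃ = ε₁ = ε₄ = 0`, `a₃ = 0`; fine chart `Φ z V Y := V`; HONESTLY LABELLED level 0 —
  print's letters are positive; the witness certifies type-correct joint satisfiability only).

HONEST FRAMING.  [bookkeeping]; the identification of `𝒢, W, J, H₁B` with [14]'s `𝔊`, `(δ∕δA′)V`, `J`, `H₁B` AT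
NODE 00's objects, of `Φ` with the exponential fine chart and of `Umin` with [14]'s minimiser is LOCATED, NOT
asserted; the printed bounds themselves ([5] Thm 3.13, Prop. 4, (114), Lemma 3) are DISPLAYED hypotheses; (α) NOT
PRINTED ∕ NOT proved; nothing of Bałaban's asserted; (M1) ∕ NE7c NOT PRINTED ∕ NOT proved; N21 NOT discharged; K3⁷ NOT
claimed; counts unmoved (typed 28∕28 · discharged 5∕27, A 5∕28); count-neutral; one finite 𝕋⁴ at fixed ε — the
Yang–Mills mass gap (Clay) is NOT proved by any of this: R4 would close the conditional finite-𝕋⁴ rung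
`BalabanLadder.UV` only; nothing continuum ∕ ℝ⁴ ∕ OS ∕ mass gap ∕ Clay.
-/

noncomputable section

open Filter Set Metric NormedSpace MeasureTheory Matrix
open scoped Topology ContDiff ENNReal

namespace Summit.QuantumFields.YangMills.Theorems.N21MinimiserResponseProp6Letters

open Literature.MathematicalPhysics.QuantumFieldTheory.Balaban1983to89.B13Contraction113 (QuadAnalytic)
open Literature.MathematicalPhysics.QuantumFieldTheory.Balaban1983to89.B11Eq174Chart (Regime solA)
open Literature.MathematicalPhysics.QuantumFieldTheory.Balaban1983to89.T4ShellMeasure (SlotAntiConcentration)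
open Summit.QuantumFields.YangMills.Theorems.N21ResponseRoadAtRegularSet
  (slotAntiConcentration_restrict_of_projectedCentre_blockExpChart_regular)
open Summit.QuantumFields.YangMills.Theorems.N21MinimiserResponseRegime (psiClause_plaqReading_of_regime)

/-! ## §1  f8's NODE-O clause from Prop. 6's printed hypotheses -/

section Prop6

variable {𝔄 : Type*} [NormedRing 𝔄] [NormedAlgebra ℂ 𝔄] [CompleteSpace 𝔄]
  {B : Type*} [Fintype B] {Z : Type*}
  {𝒴 𝒵 : Type*} [NormedAddCommGroup 𝒴] [NormedSpace ℂ 𝒴] [CompleteSpace 𝒴]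
  [NormedAddCommGroup 𝒵] [NormedSpace ℂ 𝒵] [CompleteSpace 𝒵]

/-- ★★′-P **THE PLAQUETTE READINGS OF THE MINIMISER, FROM PROP. 6's PRINTED HYPOTHESES** — f8's `hΨd` VERBATIM on
`Reg` for a selector reading the solution of (116) (no linear term) through the fine chart `Φ`: file 3 ★★′-R with its
`Regime` binder supplied by lit-balaban `Regime.ofProp6` from the norm of `𝔊` (`B₀`), the quadratic-analytic letter
of `(δ∕δA′)V` (`C₄`, `a₃`), the data bounds `‖J‖ ≤ C₁B₃ε₁`, `‖H₁B‖ < 2dLB₀C₁ε₁` and the printed numerals.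
[cite: Balaban1985Variational, Prop. 6 (117)-(121) p.295, p.309] [bookkeeping] -/
theorem psiClause_plaqReading_of_prop6Letters {Bf : Type*} [Fintype Bf] (plaqs : Finset (B × B × B × B)) (ε : ℝ)
    (𝒢 : Z → (B → 𝔄) → (𝒵 →L[ℂ] 𝒴)) (W : Z → (B → 𝔄) → 𝒴 → 𝒵) (J : Z → (B → 𝔄) → 𝒵)
    (AH : Z → (B → 𝔄) → 𝒴) {B₀ C₄ a₃ dL C₁ B₃ ε₁ ε₄ : ℝ}
    (hB₀ : 0 ≤ B₀) (hC₄ : 0 ≤ C₄) (hdL : 0 ≤ dL) (hC₁ : 0 ≤ C₁) (hε₁ : 0 ≤ ε₁) (hε₄ : 0 ≤ ε₄) (hB₃ : dL ≤ B₃)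
    (h1 : 2 * B₀ * C₁ * B₃ * ε₁ ≤ ε₄) (h2 : 4 * ε₄ ≤ a₃) (h3 : 16 * B₀ * C₄ * ε₄ ≤ 1)
    (h𝒢n : ∀ z, ∀ V ∈ {V : B → 𝔄 | (∀ b, IsUnit (V b)) ∧ ∀ p ∈ plaqs,
      ‖V p.1 * V p.2.1 * Ring.inverse (V p.2.2.1) * Ring.inverse (V p.2.2.2) - 1‖ < ε}, ∀ f, ‖𝒢 z V f‖ ≤ B₀ * ‖f‖)
    (hWq : ∀ z, ∀ V ∈ {V : B → 𝔄 | (∀ b, IsUnit (V b)) ∧ ∀ p ∈ plaqs,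
      ‖V p.1 * V p.2.1 * Ring.inverse (V p.2.2.1) * Ring.inverse (V p.2.2.2) - 1‖ < ε}, QuadAnalytic (W z V) C₄ a₃)
    (hJb : ∀ z, ∀ V ∈ {V : B → 𝔄 | (∀ b, IsUnit (V b)) ∧ ∀ p ∈ plaqs,
      ‖V p.1 * V p.2.1 * Ring.inverse (V p.2.2.1) * Ring.inverse (V p.2.2.2) - 1‖ < ε}, ‖J z V‖ ≤ C₁ * B₃ * ε₁)
    (hAb : ∀ z, ∀ V ∈ {V : B → 𝔄 | (∀ b, IsUnit (V b)) ∧ ∀ p ∈ plaqs,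
      ‖V p.1 * V p.2.1 * Ring.inverse (V p.2.2.1) * Ring.inverse (V p.2.2.2) - 1‖ < ε},
      ‖AH z V‖ < 2 * dL * B₀ * C₁ * ε₁)
    (h𝒢 : ∀ z, AnalyticOnNhd ℂ (𝒢 z) {V : B → 𝔄 | (∀ b, IsUnit (V b)) ∧ ∀ p ∈ plaqs,
      ‖V p.1 * V p.2.1 * Ring.inverse (V p.2.2.1) * Ring.inverse (V p.2.2.2) - 1‖ < ε})
    (hW : ∀ z, AnalyticOnNhd ℂ (fun p : (B → 𝔄) × 𝒴 => W z p.1 p.2)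
      ({V : B → 𝔄 | (∀ b, IsUnit (V b)) ∧ ∀ p ∈ plaqs,
        ‖V p.1 * V p.2.1 * Ring.inverse (V p.2.2.1) * Ring.inverse (V p.2.2.2) - 1‖ < ε} ×ˢ {Y : 𝒴 | ‖Y‖ < a₃}))
    (hJ : ∀ z, AnalyticOnNhd ℂ (J z) {V : B → 𝔄 | (∀ b, IsUnit (V b)) ∧ ∀ p ∈ plaqs,
      ‖V p.1 * V p.2.1 * Ring.inverse (V p.2.2.1) * Ring.inverse (V p.2.2.2) - 1‖ < ε})
    (hA : ∀ z, AnalyticOnNhd ℂ (AH z) {V : B → 𝔄 | (∀ b, IsUnit (V b)) ∧ ∀ p ∈ plaqs,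
      ‖V p.1 * V p.2.1 * Ring.inverse (V p.2.2.1) * Ring.inverse (V p.2.2.2) - 1‖ < ε})
    (Φ : Z → (B → 𝔄) → 𝒴 → (Bf → 𝔄))
    (hΦ : ∀ z, AnalyticOnNhd ℂ (fun p : (B → 𝔄) × 𝒴 => Φ z p.1 p.2)
      ({V : B → 𝔄 | (∀ b, IsUnit (V b)) ∧ ∀ p ∈ plaqs,
        ‖V p.1 * V p.2.1 * Ring.inverse (V p.2.2.1) * Ring.inverse (V p.2.2.2) - 1‖ < ε} ×ˢ
          {Y : 𝒴 | ‖Y‖ < ε₄ + 2 * dL * B₀ * C₁ * ε₁}))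
    (Umin : Z → (B → 𝔄) → (Bf → 𝔄))
    (hUmin : ∀ z, ∀ V ∈ {V : B → 𝔄 | (∀ b, IsUnit (V b)) ∧ ∀ p ∈ plaqs,
      ‖V p.1 * V p.2.1 * Ring.inverse (V p.2.2.1) * Ring.inverse (V p.2.2.2) - 1‖ < ε},
      Umin z V = Φ z V (solA (𝒢 z V) 0 (W z V) (J z V) ε₄ (AH z V) + AH z V))
    (hunit : ∀ z, ∀ V ∈ {V : B → 𝔄 | (∀ b, IsUnit (V b)) ∧ ∀ p ∈ plaqs,
      ‖V p.1 * V p.2.1 * Ring.inverse (V p.2.2.1) * Ring.inverse (V p.2.2.2) - 1‖ < ε}, ∀ b, IsUnit (Umin z V b)) :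
    ∀ (q : Bf × Bf × Bf × Bf) (z : Z), DifferentiableOn ℂ
      (fun V => Umin z V q.1 * Umin z V q.2.1 * Ring.inverse (Umin z V q.2.2.1) * Ring.inverse (Umin z V q.2.2.2) - 1)
      {V : B → 𝔄 | (∀ b, IsUnit (V b)) ∧ ∀ p ∈ plaqs,
        ‖V p.1 * V p.2.1 * Ring.inverse (V p.2.2.1) * Ring.inverse (V p.2.2.2) - 1‖ < ε} :=
  psiClause_plaqReading_of_regime plaqs ε 𝒢 (fun _ _ => 0) W J AH
    (fun z V hV => Regime.ofProp6 (h𝒢n z V hV) (hWq z V hV) hB₀ hC₄ hdL hC₁ hε₁ hε₄ hB₃ h1 h2 h3)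
    hJb hAb h𝒢 (fun _ => analyticOnNhd_const) hW hJ hA Φ hΦ Umin hUmin hunit

end Prop6

/-! ## §2  Junction BY NAME: part 34's (M1) through the exponential block chart, `hΨd` DISCHARGED into regime letters -/

section Junction

variable {𝔄 : Type*} [NormedRing 𝔄] [NormedAlgebra ℂ 𝔄] [CompleteSpace 𝔄] [NormOneClass 𝔄]
  {κ B Bf : Type*} [Fintype κ] [Fintype B] [Fintype Bf] {Z : Type*}
  {𝒴 𝒵 : Type*} [NormedAddCommGroup 𝒴] [NormedSpace ℂ 𝒴] [CompleteSpace 𝒴]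
  [NormedAddCommGroup 𝒵] [NormedSpace ℂ 𝒵] [CompleteSpace 𝒵]

/-- ★★★★-R **(M1) ON THE CUT LAW ABOUT THE A-PROJECTED CENTRE FOR THE CUBE SUP OF PLAQUETTE READINGS OF THE MINIMISER
THROUGH THE EXPONENTIAL BLOCK CHART, THE NODE-O CLAUSE's DIFFERENTIABILITY HALF IN REGIME LETTERS** — f8 ★★★★
`slotAntiConcentration_restrict_of_projectedCentre_blockExpChart_regular` BY NAME at `Ψ q z V := ∂(Umin z V)(q) − 1`
with `hΨd :=` file 3 ★★′-R; part 34's remaining binders (coercivity, Lipschitz cut action, obtuseness, farness,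
envelope, odds `Q`, `hUm`) displayed unchanged — the consumer's currency. LOCATED. [bookkeeping] -/
theorem slotAC_of_blockExpChart_regular_of_regime [Nonempty Bf] [MeasurableSpace Z] [Nonempty κ]
    (ζ : Measure Z) [SFinite ζ] (A : Matrix κ κ ℝ) (hAs : A.IsSymm) {γ G : ℝ} (hγ0 : 0 < γ)
    (hγ : ∀ x : κ → ℝ, γ * ‖x‖ ^ 2 ≤ x ⬝ᵥ (A *ᵥ x))
    (m : Z → (κ → ℝ)) {c : Z → (κ → ℝ)} (hc : Measurable c) (Pz : Z → (κ → ℝ) → ℝ)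
    (Xd : Z → κ → B → 𝔄) (V₀ : Z → B → 𝔄ˣ)
    {Ξ v v' r S δ ε ϱ R c₀ θ ρ κ₀ : ℝ} (hΞ0 : 0 ≤ Ξ) (hΞ : ∀ z b, ∑ a, ‖Xd z a b‖ ≤ Ξ) (hv0 : 0 ≤ v)
    (hv : ∀ z b, ‖(V₀ z b : 𝔄)‖ ≤ v) (hv' : ∀ z b, ‖(↑(V₀ z b)⁻¹ : 𝔄)‖ ≤ v') (hr : 0 < r) (hS0 : 0 ≤ S)
    (hsmall : Ξ * Real.exp ((ϱ + r) * Ξ) * v * r * (v' * Real.exp (ϱ * Ξ)) ≤ 1 / 2)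
    (plaqs : Finset (B × B × B × B))
    (hbudget : δ + max (Real.exp (ϱ * Ξ) * v + Ξ * Real.exp ((ϱ + r) * Ξ) * v * r)
        (2 * (v' * Real.exp (ϱ * Ξ))) ^ 3 * (2 + 4 * (v' * Real.exp (ϱ * Ξ)) ^ 2) *
        (Ξ * Real.exp ((ϱ + r) * Ξ) * v * r) < ε)
    (𝒢 : Z → (B → 𝔄) → (𝒵 →L[ℂ] 𝒴)) (Λ : Z → (B → 𝔄) → (𝒴 →L[ℂ] 𝒴)) (W : Z → (B → 𝔄) → 𝒴 → 𝒵)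
    (J : Z → (B → 𝔄) → 𝒵) (AH : Z → (B → 𝔄) → 𝒴) {B₀ θ₁ C₄ a₃ j a ε₄ : ℝ}
    (hR : ∀ z, ∀ V ∈ {V : B → 𝔄 | (∀ b, IsUnit (V b)) ∧ ∀ p ∈ plaqs,
      ‖V p.1 * V p.2.1 * Ring.inverse (V p.2.2.1) * Ring.inverse (V p.2.2.2) - 1‖ < ε},
      Regime (𝒢 z V) (Λ z V) (W z V) B₀ θ₁ C₄ a₃ j a ε₄)
    (hJb : ∀ z, ∀ V ∈ {V : B → 𝔄 | (∀ b, IsUnit (V b)) ∧ ∀ p ∈ plaqs,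
      ‖V p.1 * V p.2.1 * Ring.inverse (V p.2.2.1) * Ring.inverse (V p.2.2.2) - 1‖ < ε}, ‖J z V‖ ≤ j)
    (hAb : ∀ z, ∀ V ∈ {V : B → 𝔄 | (∀ b, IsUnit (V b)) ∧ ∀ p ∈ plaqs,
      ‖V p.1 * V p.2.1 * Ring.inverse (V p.2.2.1) * Ring.inverse (V p.2.2.2) - 1‖ < ε}, ‖AH z V‖ < a)
    (h𝒢 : ∀ z, AnalyticOnNhd ℂ (𝒢 z) {V : B → 𝔄 | (∀ b, IsUnit (V b)) ∧ ∀ p ∈ plaqs,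
      ‖V p.1 * V p.2.1 * Ring.inverse (V p.2.2.1) * Ring.inverse (V p.2.2.2) - 1‖ < ε})
    (hΛ : ∀ z, AnalyticOnNhd ℂ (Λ z) {V : B → 𝔄 | (∀ b, IsUnit (V b)) ∧ ∀ p ∈ plaqs,
      ‖V p.1 * V p.2.1 * Ring.inverse (V p.2.2.1) * Ring.inverse (V p.2.2.2) - 1‖ < ε})
    (hW : ∀ z, AnalyticOnNhd ℂ (fun p : (B → 𝔄) × 𝒴 => W z p.1 p.2)
      ({V : B → 𝔄 | (∀ b, IsUnit (V b)) ∧ ∀ p ∈ plaqs,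
        ‖V p.1 * V p.2.1 * Ring.inverse (V p.2.2.1) * Ring.inverse (V p.2.2.2) - 1‖ < ε} ×ˢ {Y : 𝒴 | ‖Y‖ < a₃}))
    (hJ : ∀ z, AnalyticOnNhd ℂ (J z) {V : B → 𝔄 | (∀ b, IsUnit (V b)) ∧ ∀ p ∈ plaqs,
      ‖V p.1 * V p.2.1 * Ring.inverse (V p.2.2.1) * Ring.inverse (V p.2.2.2) - 1‖ < ε})
    (hA : ∀ z, AnalyticOnNhd ℂ (AH z) {V : B → 𝔄 | (∀ b, IsUnit (V b)) ∧ ∀ p ∈ plaqs,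
      ‖V p.1 * V p.2.1 * Ring.inverse (V p.2.2.1) * Ring.inverse (V p.2.2.2) - 1‖ < ε})
    (Φ : Z → (B → 𝔄) → 𝒴 → (Bf → 𝔄))
    (hΦ : ∀ z, AnalyticOnNhd ℂ (fun p : (B → 𝔄) × 𝒴 => Φ z p.1 p.2)
      ({V : B → 𝔄 | (∀ b, IsUnit (V b)) ∧ ∀ p ∈ plaqs,
        ‖V p.1 * V p.2.1 * Ring.inverse (V p.2.2.1) * Ring.inverse (V p.2.2.2) - 1‖ < ε} ×ˢ
          {Y : 𝒴 | ‖Y‖ < ε₄ + a}))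
    (Umin : Z → (B → 𝔄) → (Bf → 𝔄))
    (hUmin : ∀ z, ∀ V ∈ {V : B → 𝔄 | (∀ b, IsUnit (V b)) ∧ ∀ p ∈ plaqs,
      ‖V p.1 * V p.2.1 * Ring.inverse (V p.2.2.1) * Ring.inverse (V p.2.2.2) - 1‖ < ε},
      Umin z V = Φ z V (solA (𝒢 z V) (Λ z V) (W z V) (J z V) ε₄ (AH z V) + AH z V))
    (hunit : ∀ z, ∀ V ∈ {V : B → 𝔄 | (∀ b, IsUnit (V b)) ∧ ∀ p ∈ plaqs,
      ‖V p.1 * V p.2.1 * Ring.inverse (V p.2.2.1) * Ring.inverse (V p.2.2.2) - 1‖ < ε}, ∀ b, IsUnit (Umin z V b))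
    (hΨS : ∀ (q : Bf × Bf × Bf × Bf) z, ∀ V ∈ {V : B → 𝔄 | (∀ b, IsUnit (V b)) ∧ ∀ p ∈ plaqs,
      ‖V p.1 * V p.2.1 * Ring.inverse (V p.2.2.1) * Ring.inverse (V p.2.2.2) - 1‖ < ε},
      ‖Umin z V q.1 * Umin z V q.2.1 * Ring.inverse (Umin z V q.2.2.1) * Ring.inverse (Umin z V q.2.2.2) - 1‖ ≤ S)
    (Kc : Z → Set (κ → ℝ)) (hKϱ : ∀ z, ∀ x ∈ Kc z, ‖x‖ ≤ ϱ)
    (hreg : ∀ z, ∀ x ∈ Kc z, ∀ p ∈ plaqs,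
      ‖exp (∑ a, (x a : ℂ) • Xd z a p.1) * (V₀ z p.1 : 𝔄) * (exp (∑ a, (x a : ℂ) • Xd z a p.2.1) * (V₀ z p.2.1 : 𝔄)) *
        Ring.inverse (exp (∑ a, (x a : ℂ) • Xd z a p.2.2.1) * (V₀ z p.2.2.1 : 𝔄)) *
        Ring.inverse (exp (∑ a, (x a : ℂ) • Xd z a p.2.2.2) * (V₀ z p.2.2.2 : 𝔄)) - 1‖ ≤ δ)
    (hg : Measurable fun p : Z × (κ → ℝ) => (Kc p.1).indicator (fun w => ENNReal.ofReal (Real.exp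
        (-(1 / 2 * ((w - m p.1) ⬝ᵥ (A *ᵥ (w - m p.1))) + Pz p.1 w)))) p.2)
    (hKR : ∀ z, ∀ w ∈ Kc z, ‖w - c z‖ ≤ R) (hRr : 2 * R < r)
    (hc₀ : ∀ (q : Bf × Bf × Bf × Bf) z,
      ‖Umin z (fun b => exp (∑ a, ((c z a : ℝ) : ℂ) • Xd z a b) * (V₀ z b : 𝔄)) q.1 *
        Umin z (fun b => exp (∑ a, ((c z a : ℝ) : ℂ) • Xd z a b) * (V₀ z b : 𝔄)) q.2.1 *
        Ring.inverse (Umin z (fun b => exp (∑ a, ((c z a : ℝ) : ℂ) • Xd z a b) * (V₀ z b : 𝔄)) q.2.2.1) *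
        Ring.inverse (Umin z (fun b => exp (∑ a, ((c z a : ℝ) : ℂ) • Xd z a b) * (V₀ z b : 𝔄)) q.2.2.2) - 1‖ ≤ c₀)
    (hUm : Measurable fun p : Z × (κ → ℝ) => (⨆ q : Bf × Bf × Bf × Bf,
      ‖Umin p.1 (fun b => exp (∑ a, ((p.2 a : ℝ) : ℂ) • Xd p.1 a b) * (V₀ p.1 b : 𝔄)) q.1 *
        Umin p.1 (fun b => exp (∑ a, ((p.2 a : ℝ) : ℂ) • Xd p.1 a b) * (V₀ p.1 b : 𝔄)) q.2.1 *
        Ring.inverse (Umin p.1 (fun b => exp (∑ a, ((p.2 a : ℝ) : ℂ) • Xd p.1 a b) * (V₀ p.1 b : 𝔄)) q.2.2.1) *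
        Ring.inverse (Umin p.1 (fun b => exp (∑ a, ((p.2 a : ℝ) : ℂ) • Xd p.1 a b) * (V₀ p.1 b : 𝔄)) q.2.2.2) - 1‖))
    {C Env : Set (Z × (κ → ℝ))} (hC : MeasurableSet C) (hEnv : MeasurableSet Env)
    (hCK : ∀ p ∈ C, p.2 ∈ Kc p.1)
    {Q : ℝ} (hθ : 0 < θ) (hρ0 : 0 < ρ) (hρ1 : ρ < 1) (hκ : 0 < κ₀) (hQ0 : 0 ≤ Q)
    (hnum : c₀ + 4 * (2 * (2 * S) / r ^ 2) * R ^ 2 ≤ (1 - κ₀) * (θ * (1 - ρ)))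
    (hK : ∀ z, Convex ℝ (Kc z)) (hcK : ∀ z, c z ∈ Kc z)
    (hP : ∀ z, ∀ v ∈ Kc z, ∀ v' ∈ Kc z, Pz z v - Pz z v' ≤ G * ‖v - v'‖) :
    let Ψ : (Bf × Bf × Bf × Bf) → Z → (B → 𝔄) → 𝔄 := fun q z V =>
      Umin z V q.1 * Umin z V q.2.1 * Ring.inverse (Umin z V q.2.2.1) * Ring.inverse (Umin z V q.2.2.2) - 1
    let U : Z × (κ → ℝ) → ℝ := fun p =>
      ⨆ q, ‖Ψ q p.1 (fun b => exp (∑ a, ((p.2 a : ℝ) : ℂ) • Xd p.1 a b) * (V₀ p.1 b : 𝔄))‖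
    let ν : Measure (Z × (κ → ℝ)) := (ζ.prod volume).withDensity fun p : Z × (κ → ℝ) =>
      (Kc p.1).indicator (fun w => ENNReal.ofReal (Real.exp
        (-(1 / 2 * ((w - m p.1) ⬝ᵥ (A *ᵥ (w - m p.1))) + Pz p.1 w)))) p.2
    (∀ p : Z × (κ → ℝ), θ * (1 - ρ) ≤ U p → U p < θ → p ∈ C → p.2 ∈ Kc p.1 →
        0 ≤ (c p.1 - m p.1) ⬝ᵥ (A *ᵥ (p.2 - c p.1))) →
    (∀ p : Z × (κ → ℝ), θ * (1 - ρ) ≤ U p → U p < θ → p ∈ C → p.2 ∈ Kc p.1 → 2 * G ≤ γ * ‖p.2 - c p.1‖) →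
    (∀ l ∈ Icc (1 - 1 / ((Fintype.card κ : ℝ) + 1)) 1, ∀ p : Z × (κ → ℝ),
        θ * (1 - ρ) ≤ U p → U p < θ → p ∈ C → (p.1, c p.1 + l • (p.2 - c p.1)) ∈ Env) →
    ν (Env \ ({p | U p < θ} ∩ C)) ≤ ENNReal.ofReal Q * ν ({p | U p < θ} ∩ C) →
    SlotAntiConcentration (ν.restrict ({p | U p < θ} ∩ C)) U θ ρ
      (3 * ((Fintype.card κ : ℝ) + 1) * (1 + Q) / (κ₀ * (1 - ρ))) := by
  intro Ψ U ν hobt hfar henv hQ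
  exact slotAntiConcentration_restrict_of_projectedCentre_blockExpChart_regular ζ A hAs hγ0 hγ m hc Pz Xd V₀ hΞ0 hΞ
    hv0 hv hv' hr hS0 hsmall plaqs hbudget Ψ
    (psiClause_plaqReading_of_regime plaqs ε 𝒢 Λ W J AH hR hJb hAb h𝒢 hΛ hW hJ hA Φ hΦ Umin hUmin hunit)
    (fun q z V hV => hΨS q z V hV) Kc hKϱ hreg hg hKR hRr (fun q z => hc₀ q z) hUm hC hEnv hCK hθ hρ0 hρ1 hκ hQ0
    hnum hK hcK hP hobt hfar henv hQ

end Junction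

/-! ## §3  A2∕A6: the Prop.-6-letter binder system of ★★′-P is jointly inhabited in every `𝔄` — the level-0 data -/

section Witness

variable {𝔄 : Type*} [NormedRing 𝔄] [NormedAlgebra ℂ 𝔄] {B : Type*} [Fintype B] {Z : Type*}

/-- **A2∕A6 — THE LEVEL-0 DATA INHABIT THE BINDER SYSTEM KEPT BY ★★′-P**: carriers `𝒴 = 𝒵 := B → 𝔄`, ZERO data
`𝔊 = 0`, `(δ∕δA′)V = 0`, `J = 0`, `H₁B = 0`, letters `B₀ = dL = C₁ = B₃ = ε₁ = 1`, `C₄ = 0`, `ε₄ = 2`, `a₃ = 8` (the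
strict data bound `‖H₁B‖ < 2dLB₀C₁ε₁` needs a positive right side; the ten numeral rows hold: `2 ≤ 2`, `8 ≤ 8`,
`0 ≤ 1`, …), `Φ z V Y := V`, `Umin z V := V`: every binder of ★★′-P (numerals, norm of `𝔊`, quadratic-analyticity of
`(δ∕δA′)V`, data bounds, the five analyticity letters, the reading identity, unit values) holds — in EVERY `𝔄`.
HONESTLY LABELLED level 0: NOT print's letters, NOT NODE 00's objects; type-correct joint satisfiability only.
[bookkeeping] -/
theorem prop6Letters_levelZero_witness (plaqs : Finset (B × B × B × B)) (ε : ℝ) :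
    ∃ (𝒢 : Z → (B → 𝔄) → ((B → 𝔄) →L[ℂ] (B → 𝔄))) (W : Z → (B → 𝔄) → (B → 𝔄) → (B → 𝔄))
      (J : Z → (B → 𝔄) → (B → 𝔄)) (AH : Z → (B → 𝔄) → (B → 𝔄)) (Φ : Z → (B → 𝔄) → (B → 𝔄) → (B → 𝔄))
      (Umin : Z → (B → 𝔄) → (B → 𝔄)) (B₀ C₄ a₃ dL C₁ B₃ ε₁ ε₄ : ℝ),
      0 ≤ B₀ ∧ 0 ≤ C₄ ∧ 0 ≤ dL ∧ 0 ≤ C₁ ∧ 0 ≤ ε₁ ∧ 0 ≤ ε₄ ∧ dL ≤ B₃ ∧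
      2 * B₀ * C₁ * B₃ * ε₁ ≤ ε₄ ∧ 4 * ε₄ ≤ a₃ ∧ 16 * B₀ * C₄ * ε₄ ≤ 1 ∧
      (∀ z : Z, ∀ V ∈ {V : B → 𝔄 | (∀ b, IsUnit (V b)) ∧ ∀ p ∈ plaqs,
          ‖V p.1 * V p.2.1 * Ring.inverse (V p.2.2.1) * Ring.inverse (V p.2.2.2) - 1‖ < ε},
        ∀ f, ‖𝒢 z V f‖ ≤ B₀ * ‖f‖) ∧
      (∀ z : Z, ∀ V ∈ {V : B → 𝔄 | (∀ b, IsUnit (V b)) ∧ ∀ p ∈ plaqs,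
          ‖V p.1 * V p.2.1 * Ring.inverse (V p.2.2.1) * Ring.inverse (V p.2.2.2) - 1‖ < ε},
        QuadAnalytic (W z V) C₄ a₃) ∧
      (∀ z : Z, ∀ V ∈ {V : B → 𝔄 | (∀ b, IsUnit (V b)) ∧ ∀ p ∈ plaqs,
          ‖V p.1 * V p.2.1 * Ring.inverse (V p.2.2.1) * Ring.inverse (V p.2.2.2) - 1‖ < ε},
        ‖J z V‖ ≤ C₁ * B₃ * ε₁) ∧
      (∀ z : Z, ∀ V ∈ {V : B → 𝔄 | (∀ b, IsUnit (V b)) ∧ ∀ p ∈ plaqs,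
          ‖V p.1 * V p.2.1 * Ring.inverse (V p.2.2.1) * Ring.inverse (V p.2.2.2) - 1‖ < ε},
        ‖AH z V‖ < 2 * dL * B₀ * C₁ * ε₁) ∧
      (∀ z : Z, AnalyticOnNhd ℂ (𝒢 z) {V : B → 𝔄 | (∀ b, IsUnit (V b)) ∧ ∀ p ∈ plaqs,
          ‖V p.1 * V p.2.1 * Ring.inverse (V p.2.2.1) * Ring.inverse (V p.2.2.2) - 1‖ < ε}) ∧
      (∀ z : Z, AnalyticOnNhd ℂ (fun p : (B → 𝔄) × (B → 𝔄) => W z p.1 p.2)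
          ({V : B → 𝔄 | (∀ b, IsUnit (V b)) ∧ ∀ p ∈ plaqs,
            ‖V p.1 * V p.2.1 * Ring.inverse (V p.2.2.1) * Ring.inverse (V p.2.2.2) - 1‖ < ε} ×ˢ
              {Y : B → 𝔄 | ‖Y‖ < a₃})) ∧
      (∀ z : Z, AnalyticOnNhd ℂ (J z) {V : B → 𝔄 | (∀ b, IsUnit (V b)) ∧ ∀ p ∈ plaqs,
          ‖V p.1 * V p.2.1 * Ring.inverse (V p.2.2.1) * Ring.inverse (V p.2.2.2) - 1‖ < ε}) ∧
      (∀ z : Z, AnalyticOnNhd ℂ (AH z) {V : B → 𝔄 | (∀ b, IsUnit (V b)) ∧ ∀ p ∈ plaqs,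
          ‖V p.1 * V p.2.1 * Ring.inverse (V p.2.2.1) * Ring.inverse (V p.2.2.2) - 1‖ < ε}) ∧
      (∀ z : Z, AnalyticOnNhd ℂ (fun p : (B → 𝔄) × (B → 𝔄) => Φ z p.1 p.2)
          ({V : B → 𝔄 | (∀ b, IsUnit (V b)) ∧ ∀ p ∈ plaqs,
            ‖V p.1 * V p.2.1 * Ring.inverse (V p.2.2.1) * Ring.inverse (V p.2.2.2) - 1‖ < ε} ×ˢ
              {Y : B → 𝔄 | ‖Y‖ < ε₄ + 2 * dL * B₀ * C₁ * ε₁})) ∧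
      (∀ z : Z, ∀ V ∈ {V : B → 𝔄 | (∀ b, IsUnit (V b)) ∧ ∀ p ∈ plaqs,
          ‖V p.1 * V p.2.1 * Ring.inverse (V p.2.2.1) * Ring.inverse (V p.2.2.2) - 1‖ < ε},
        Umin z V = Φ z V (solA (𝒢 z V) 0 (W z V) (J z V) ε₄ (AH z V) + AH z V)) ∧
      (∀ z : Z, ∀ V ∈ {V : B → 𝔄 | (∀ b, IsUnit (V b)) ∧ ∀ p ∈ plaqs,
          ‖V p.1 * V p.2.1 * Ring.inverse (V p.2.2.1) * Ring.inverse (V p.2.2.2) - 1‖ < ε}, ∀ b, IsUnit (Umin z V b)) := by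
  refine ⟨fun _ _ => 0, fun _ _ _ => 0, fun _ _ => 0, fun _ _ => 0, fun _ V _ => V, fun _ V => V,
    1, 0, 8, 1, 1, 1, 1, 2, zero_le_one, le_rfl, zero_le_one, zero_le_one, zero_le_one, by norm_num, le_rfl,
    by norm_num, by norm_num, by norm_num, fun _ V _ f => by simp, fun _ V _ => ⟨fun Y _ => by simp,
    fun P Q => differentiableOn_const _⟩, fun _ V _ => by simp, fun _ V _ => by simp,
    fun _ => analyticOnNhd_const, fun _ => analyticOnNhd_const, fun _ => analyticOnNhd_const,
    fun _ => analyticOnNhd_const, fun _ => fun p _ => analyticAt_fst, fun _ V _ => rfl, fun _ V hV => hV.1⟩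

end Witness

end Summit.QuantumFields.YangMills.Theorems.N21MinimiserResponseProp6Letters
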